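import Mathlib.LinearAlgebra.Matrix.Determinant.Basic
import Mathlib.Data.Fintype.Card
import Mathlib.Data.Int.Order.Units
import Mathlib.Algebra.Algebra.Operations
import Mathlib.Algebra.BigOperators.Pi
import HarnessLib

/-!
# Maximal minors of a block-diagonal rectangular family are the products of the maximal minors of the blocks
# (crux `FInjectiveMacaulayfication` stmt-ResolutionOfSingularities-15315, chain w45a; part «I₁₆(diag) = I₈ · I₈» of piece (S) of res-L1-w45a-lead-1 g8's TIER-2 FILE PLAN
# 06:27:54Z for LEMMA N♭ (two identical 8 × 8 Frobenius blocks); seat res-L1-w45a-stub-1 g9)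

[OURS · L1 W4.5a] Support file (`--supports stmt-ResolutionOfSingularities-15315 --as helper`); pure matrix algebra over a commutative ring `S` with spans over a
ring of scalars `R → S`; def-free, unconditional. AI-written (AI review is weaker than expert review). Companion of `…FrobeniusNormMinors.lean` / `…UnitRowMinors.lean`.

* `det_rows_eq_zero_of_supported` — FROBENIUS–KÖNIG, light form: if more than `#C` rows of a square matrix are supported on the columns `C`, the determinant is `0`
  (multilinear expansion of those rows in the unit vectors of `C`, `MultilinearMap.map_sum_finset`, + pigeonhole).
* `det_blockRows_sumMap` — a selection `Sum.map σ₀ σ₁` of rows of the block family `(G₀ ⊕ 0, 0 ⊕ G₁)` gives `fromBlocks`, determinant `det(G₀ ∘ σ₀) · det(G₁ ∘ σ₁)`.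
* ★★ `span_maximalMinors_blockRows_eq_mul` — the `R`-span of ALL maximal minors of the block-diagonal rectangular family (rows `N₀ ⊕ N₁`, columns `ι₀ ⊕ ι₁`) is the
  PRODUCT of the `R`-spans of the maximal minors of the two blocks: `I(diag(G₀, G₁)) = I(G₀) · I(G₁)` (selections with the wrong block count vanish by Frobenius–König;
  the others are `±` products after a row permutation, `Matrix.det_permute`).

[folklore]
-/

namespace Summit.ResolutionOfSingularities.ResolutionOfSingularities.Theorems.FInjectiveMacaulayfication.BlockDiagonalMinors

set_option linter.dupNamespace false

open Matrix

variable {S : Type*} [CommRing S] {R : Type*} [CommRing R] [Algebra R S]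

/-! ## §1 Frobenius–König (light) -/

omit [Algebra R S] in
/-- **Too many rows supported on too few columns ⇒ `det = 0`.** If every row `x ∈ T` of `v` vanishes outside the columns `C` and `#C < #T`, then `det v = 0`. [folklore] -/
theorem det_rows_eq_zero_of_supported {κ : Type*} [Fintype κ] [DecidableEq κ] (v : κ → κ → S) (T C : Finset κ)
    (hsupp : ∀ x ∈ T, ∀ y, y ∉ C → v x y = 0) (hcard : C.card < T.card) : (Matrix.of v).det = 0 := by
  classical
  let f : MultilinearMap S (fun _ : κ => κ → S) S := (Matrix.detRowAlternating : (κ → S) [⋀^κ]→ₗ[S] S).toMultilinearMap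
  have hf : ∀ w : κ → κ → S, (Matrix.of w).det = f w := fun w => rfl
  let A : κ → Finset κ := fun x => if x ∈ T then C else {x}
  let g : κ → κ → (κ → S) := fun x y => if x ∈ T then v x y • (Pi.single y 1 : κ → S) else v x
  have hrows : (fun x => ∑ y ∈ A x, g x y) = v := by
    funext x
    by_cases hx : x ∈ T
    · simp only [A, g, if_pos hx]
      calc ∑ y ∈ C, v x y • (Pi.single y 1 : κ → S) = ∑ y, v x y • (Pi.single y 1 : κ → S) :=
            Finset.sum_subset (Finset.subset_univ C) fun y _ hy => by rw [hsupp x hx y hy, zero_smul]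
        _ = v x := (pi_eq_sum_univ' (v x)).symm
    · simp only [A, g, if_neg hx, Finset.sum_singleton]
  rw [hf, ← hrows, MultilinearMap.map_sum_finset f g A]
  refine Finset.sum_eq_zero fun τ hτ => ?_
  rw [Fintype.mem_piFinset] at hτ
  -- pigeonhole: two rows of `T` expand along the same unit vector
  have hmaps : Set.MapsTo τ T C := fun x hx => by
    have := hτ x
    simp only [A, if_pos (Finset.mem_coe.mp hx)] at this
    exact this
  obtain ⟨x, hx, x', hx', hne, hxx'⟩ := Finset.exists_ne_map_eq_of_card_lt_of_maps_to hcard hmaps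
  let c : κ → S := fun z => if z ∈ T then v z (τ z) else 1
  let w : κ → κ → S := fun z => if z ∈ T then (Pi.single (τ z) 1 : κ → S) else v z
  have hgw : (fun z => g z (τ z)) = fun z => c z • w z := by
    funext z
    by_cases hz : z ∈ T
    · simp only [g, c, w, if_pos hz]
    · simp only [g, c, w, if_neg hz, one_smul]
  have hw : f w = 0 := by
    rw [← hf]
    refine det_zero_of_row_eq hne ?_
    change w x = w x'
    simp only [w, if_pos hx, if_pos hx', hxx']
  rw [hgw, f.map_smul_univ c w, hw, smul_zero]

/-! ## §2 Block-diagonal rectangular families -/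

variable {ι₀ ι₁ : Type*} [Fintype ι₀] [Fintype ι₁] [DecidableEq ι₀] [DecidableEq ι₁] {N₀ N₁ : Type*}

omit [Algebra R S] [Fintype ι₀] [Fintype ι₁] [DecidableEq ι₀] [DecidableEq ι₁] in
/-- A selection of the form `Sum.map σ₀ σ₁` of rows of the block family is block-diagonal. -/
theorem of_blockRows_sumMap (G₀ : N₀ → ι₀ → S) (G₁ : N₁ → ι₁ → S) (σ₀ : ι₀ → N₀) (σ₁ : ι₁ → N₁) :
    (Matrix.of fun x : ι₀ ⊕ ι₁ =>
        Sum.elim (fun a => Sum.elim (G₀ a) (0 : ι₁ → S)) (fun b => Sum.elim (0 : ι₀ → S) (G₁ b)) (Sum.map σ₀ σ₁ x)) =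
      Matrix.fromBlocks (Matrix.of fun i => G₀ (σ₀ i)) 0 0 (Matrix.of fun i => G₁ (σ₁ i)) := by
  ext x y
  rcases x with i | i' <;> rcases y with j | j' <;> simp

omit [Algebra R S] in
/-- Its determinant is the product of the two block minors. -/
theorem det_blockRows_sumMap (G₀ : N₀ → ι₀ → S) (G₁ : N₁ → ι₁ → S) (σ₀ : ι₀ → N₀) (σ₁ : ι₁ → N₁) :
    (Matrix.of fun x : ι₀ ⊕ ι₁ =>
        Sum.elim (fun a => Sum.elim (G₀ a) (0 : ι₁ → S)) (fun b => Sum.elim (0 : ι₀ → S) (G₁ b)) (Sum.map σ₀ σ₁ x)).det =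
      (Matrix.of fun i => G₀ (σ₀ i)).det * (Matrix.of fun i => G₁ (σ₁ i)).det := by
  rw [of_blockRows_sumMap, det_fromBlocks_zero₁₂]

/-- ★ Every maximal minor of the block-diagonal rectangular family lies in `I(G₀) · I(G₁)` (it is `0` or `±` a product of block minors). [folklore] -/
theorem det_blockRows_mem_mul (G₀ : N₀ → ι₀ → S) (G₁ : N₁ → ι₁ → S) (σ : ι₀ ⊕ ι₁ → N₀ ⊕ N₁) :
    (Matrix.of fun x : ι₀ ⊕ ι₁ =>
        Sum.elim (fun a => Sum.elim (G₀ a) (0 : ι₁ → S)) (fun b => Sum.elim (0 : ι₀ → S) (G₁ b)) (σ x)).det ∈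
      Submodule.span R (Set.range fun σ₀ : ι₀ → N₀ => (Matrix.of fun i => G₀ (σ₀ i)).det) *
        Submodule.span R (Set.range fun σ₁ : ι₁ → N₁ => (Matrix.of fun i => G₁ (σ₁ i)).det) := by
  classical
  set BR : N₀ ⊕ N₁ → ι₀ ⊕ ι₁ → S :=
    Sum.elim (fun a => Sum.elim (G₀ a) (0 : ι₁ → S)) (fun b => Sum.elim (0 : ι₀ → S) (G₁ b)) with hBR
  let P : ι₀ ⊕ ι₁ → Prop := fun x => ∃ a, σ x = Sum.inl a
  have hnP : ∀ x, ¬ P x → ∃ b, σ x = Sum.inr b := by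
    intro x hx
    rcases h : σ x with a | b
    · exact absurd ⟨a, h⟩ hx
    · exact ⟨b, rfl⟩
  -- support of the two kinds of rows
  have hPsupp : ∀ x, P x → ∀ j : ι₁, BR (σ x) (Sum.inr j) = 0 := by
    rintro x ⟨a, ha⟩ j
    rw [ha, hBR, Sum.elim_inl, Sum.elim_inr, Pi.zero_apply]
  have hnPsupp : ∀ x, ¬ P x → ∀ i : ι₀, BR (σ x) (Sum.inl i) = 0 := by
    intro x hx i
    obtain ⟨b, hb⟩ := hnP x hx
    rw [hb, hBR, Sum.elim_inr, Sum.elim_inl, Pi.zero_apply]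
  let T₀ : Finset (ι₀ ⊕ ι₁) := Finset.univ.filter P
  let T₁ : Finset (ι₀ ⊕ ι₁) := Finset.univ.filter fun x => ¬ P x
  let C₀ : Finset (ι₀ ⊕ ι₁) := Finset.univ.image Sum.inl
  let C₁ : Finset (ι₀ ⊕ ι₁) := Finset.univ.image Sum.inr
  have hC₀ : C₀.card = Fintype.card ι₀ := by
    rw [Finset.card_image_of_injective _ Sum.inl_injective, Finset.card_univ]
  have hC₁ : C₁.card = Fintype.card ι₁ := by
    rw [Finset.card_image_of_injective _ Sum.inr_injective, Finset.card_univ]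
  have hT : T₀.card + T₁.card = Fintype.card ι₀ + Fintype.card ι₁ := by
    rw [Finset.card_filter_add_card_filter_not, Finset.card_univ, Fintype.card_sum]
  by_cases hA : T₀.card = Fintype.card ι₀
  swap
  · -- wrong block count: the minor vanishes
    have h0 : (Matrix.of fun x => BR (σ x)).det = 0 := by
      rcases Nat.lt_or_gt_of_ne hA with hlt | hgt
      · -- too many `N₁`-rows on the `ι₁`-columns
        refine det_rows_eq_zero_of_supported _ T₁ C₁ (fun x hx y hy => ?_) (by rw [hC₁]; omega)
        have hx' : ¬ P x := (Finset.mem_filter.mp hx).2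
        rcases y with i | j
        · exact hnPsupp x hx' i
        · exact absurd (Finset.mem_image.mpr ⟨j, Finset.mem_univ _, rfl⟩) hy
      · refine det_rows_eq_zero_of_supported _ T₀ C₀ (fun x hx y hy => ?_) (by rw [hC₀]; omega)
        have hx' : P x := (Finset.mem_filter.mp hx).2
        rcases y with i | j
        · exact absurd (Finset.mem_image.mpr ⟨i, Finset.mem_univ _, rfl⟩) hy
        · exact hPsupp x hx' j
    rw [h0]
    exact Submodule.zero_mem _
  -- right block count: permute the rows into block position
  have hcard₀ : Fintype.card ι₀ = Fintype.card {x // P x} := by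
    rw [Fintype.card_subtype]; exact hA.symm
  have hcard₁ : Fintype.card ι₁ = Fintype.card {x // ¬ P x} := by
    rw [Fintype.card_subtype_compl, ← hcard₀, Fintype.card_sum]; omega
  let e₀ : ι₀ ≃ {x // P x} := Fintype.equivOfCardEq hcard₀
  let e₁ : ι₁ ≃ {x // ¬ P x} := Fintype.equivOfCardEq hcard₁
  let π : Equiv.Perm (ι₀ ⊕ ι₁) := (Equiv.sumCongr e₀ e₁).trans (Equiv.sumCompl P)
  have hπ_inl : ∀ i, π (Sum.inl i) = (e₀ i).1 := fun i => rfl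
  have hπ_inr : ∀ i', π (Sum.inr i') = (e₁ i').1 := fun i' => rfl
  let σ₀ : ι₀ → N₀ := fun i => Classical.choose (e₀ i).2
  have hσ₀ : ∀ i, σ (e₀ i).1 = Sum.inl (σ₀ i) := fun i => Classical.choose_spec (e₀ i).2
  have hx₁ : ∀ i', ∃ b, σ (e₁ i').1 = Sum.inr b := fun i' => hnP _ (e₁ i').2
  choose σ₁ hσ₁ using hx₁
  have hσπ : (fun x => σ (π x)) = Sum.map σ₀ σ₁ := by
    funext x
    rcases x with i | i'
    · rw [hπ_inl, hσ₀, Sum.map_inl]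
    · rw [hπ_inr, hσ₁, Sum.map_inr]
  have hsub : (Matrix.of fun x => BR (σ x)).submatrix π id = Matrix.of fun x => BR (Sum.map σ₀ σ₁ x) := by
    ext x y
    simp only [submatrix_apply, Matrix.of_apply, id]
    rw [← hσπ]
  have hdetπ := det_permute π (Matrix.of fun x => BR (σ x))
  rw [hsub, hBR, det_blockRows_sumMap] at hdetπ
  -- `det₀ · det₁ = sign π · det` ⇒ `det = ± det₀ · det₁`
  have hprod : (Matrix.of fun i => G₀ (σ₀ i)).det * (Matrix.of fun i => G₁ (σ₁ i)).det ∈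
      Submodule.span R (Set.range fun σ₀ : ι₀ → N₀ => (Matrix.of fun i => G₀ (σ₀ i)).det) *
        Submodule.span R (Set.range fun σ₁ : ι₁ → N₁ => (Matrix.of fun i => G₁ (σ₁ i)).det) :=
    Submodule.mul_mem_mul (Submodule.subset_span ⟨σ₀, rfl⟩) (Submodule.subset_span ⟨σ₁, rfl⟩)
  rcases Int.units_eq_one_or (Equiv.Perm.sign π) with h | h
  · rw [h, Units.val_one, Int.cast_one, one_mul] at hdetπ
    rw [← hdetπ]
    exact hprod
  · rw [h, Units.val_neg, Units.val_one, Int.cast_neg, Int.cast_one, neg_one_mul] at hdetπ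
    rw [← neg_neg (Matrix.det _), ← hdetπ]
    exact Submodule.neg_mem _ hprod

/-- ★★ **Maximal minors of a block-diagonal rectangular family = products of the maximal minors of the blocks**: `I(diag(G₀, G₁)) = I(G₀) · I(G₁)` as `R`-submodules
of `S`. [folklore] -/
theorem span_maximalMinors_blockRows_eq_mul (G₀ : N₀ → ι₀ → S) (G₁ : N₁ → ι₁ → S) :
    Submodule.span R (Set.range fun σ : ι₀ ⊕ ι₁ → N₀ ⊕ N₁ => (Matrix.of fun x : ι₀ ⊕ ι₁ =>
        Sum.elim (fun a => Sum.elim (G₀ a) (0 : ι₁ → S)) (fun b => Sum.elim (0 : ι₀ → S) (G₁ b)) (σ x)).det) =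
      Submodule.span R (Set.range fun σ₀ : ι₀ → N₀ => (Matrix.of fun i => G₀ (σ₀ i)).det) *
        Submodule.span R (Set.range fun σ₁ : ι₁ → N₁ => (Matrix.of fun i => G₁ (σ₁ i)).det) := by
  refine le_antisymm (Submodule.span_le.mpr ?_) ?_
  · rintro d ⟨σ, rfl⟩
    exact det_blockRows_mem_mul G₀ G₁ σ
  · rw [Submodule.span_mul_span]
    refine Submodule.span_le.mpr ?_
    rintro d hd
    obtain ⟨a, ⟨σ₀, rfl⟩, b, ⟨σ₁, rfl⟩, rfl⟩ := Set.mem_mul.mp hd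
    exact Submodule.subset_span ⟨Sum.map σ₀ σ₁, det_blockRows_sumMap G₀ G₁ σ₀ σ₁⟩

end Summit.ResolutionOfSingularities.ResolutionOfSingularities.Theorems.FInjectiveMacaulayfication.BlockDiagonalMinors
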